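import Mathlib

/-!
# Route `FilamentSkeletonRss` · crux `SelectionBoxRJ` (stmt-NavierStokesRegularity-21220) — rung tools:
# numeric constants of the a-posteriori true-kernel rung

Lane `ns-filament-19175-p1` (g7); helper file `--supports stmt-NavierStokesRegularity-21220`, route-independent.

With `G = √Γ`, `L = log Γ`, `M = √L`, the LIA window `δ = e⁻²/2` (waist units), the core `e = G⁻¹`, the local-induction
coefficient `Λ = arsinh(δ/e) − δ/√(δ² + e²)` of `…RungLiaReduction.nearStraight_liaReduction`, and the PHYSICAL cut-off
coefficient `η = ((Γ·4/(4π))·Λ)⁻¹` (so that `η⁻¹ x′×x″` is exactly the leading local-induction term of the regularised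
Biot–Savart self-field of a filament of circulation `4Γ`), for `0 < Rb ≤ 1/500`, `Γ ≥ exp(Rb⁻²)`:

* `arsinh_ge_log_two_mul`, `lia_coefficient_lower` — `Λ ≥ L/2 − 3 > 0`;
* `defect_constants` — `Γ ≥ 10⁴`, `0 < η`, `η·Γ log Γ ≤ 7` (so the R2 theorems apply with this `η`), and the waist-unit
  curvature and `C^{2,1}` modulus of the R2 arc are tiny: `κ̃₀ = G·η·A ≤ 1/4000`, `H̃ = Γ·(ηD·A + η(ηA² + 47/10 + M′)) ≤ 1/140`
  (`A = (47/10)(G/5 + S₂) + (17/10)G`, `D = 3/(S₂ − S₁)`, `M′ = 12 + 710/3000`);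
* `defect_rem` — for such `κ̃₀, H̃`: `δ` is inside the Taylor window and the remainder of `nearStraight_liaReduction` with
  `θ = 1/3000`, `c = 1 − θ` is `≤ 1/20`.

HONEST FRAMING.  Arithmetic for the rung ladder of a HYPOTHETICAL filament box; nothing here is a claim about Navier–Stokes
regularity or blow-up.
-/

set_option linter.dupNamespace false -- `Theorems.…Theorems`-style path/namespace repetition is the tree convention

noncomputable section

namespace Summit.NavierStokesRegularity.NavierStokesRegularity.Theorems

open Set Function Filter Real
open scoped Topology

namespace SelectionBoxRJRung

/-- `arsinh y ≥ log(2y)` for `y > 0`. [folklore] -/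
theorem arsinh_ge_log_two_mul {y : ℝ} (hy : 0 < y) : Real.log (2 * y) ≤ Real.arsinh y := by
  unfold Real.arsinh
  refine Real.log_le_log (by positivity) ?_
  have : y ≤ Real.sqrt (1 + y ^ 2) := Real.le_sqrt_of_sq_le (by nlinarith)
  linarith

/-- `e² ≤ 7.3891` and `e⁻² ≤ 0.1354`, `e⁻² ≥ 0.1353`. [folklore] -/
theorem exp_two_bounds : Real.exp 2 ≤ 7.3891 ∧ Real.exp (-2) ≤ 0.1354 ∧ 0.1353 ≤ Real.exp (-2) := by
  have h1 := Real.exp_one_lt_d9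
  have h2 := Real.exp_one_gt_d9
  have he2 : Real.exp 2 = Real.exp 1 * Real.exp 1 := by rw [← Real.exp_add]; norm_num
  have hpos := Real.exp_pos (1:ℝ)
  have hup : Real.exp 2 ≤ 7.3891 := by rw [he2]; nlinarith
  have hlo : 7.389 ≤ Real.exp 2 := by rw [he2]; nlinarith
  refine ⟨hup, ?_, ?_⟩
  · rw [Real.exp_neg, inv_le_comm₀ (Real.exp_pos _) (by norm_num)]; linarith
  · rw [Real.exp_neg, le_inv_comm₀ (by norm_num) (Real.exp_pos _)]; linarith

/-- **The local-induction coefficient is at least `log Γ/2 − 3`.**  With `G = √Γ > 0`, `δ = e⁻²/2`, `e = G⁻¹`: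
`arsinh(δ/e) − δ/√(δ² + e²) ≥ log Γ/2 − 3`. [folklore] -/
theorem lia_coefficient_lower {Γ : ℝ} (hΓ : 0 < Γ) :
    Real.log Γ / 2 - 3 ≤ Real.arsinh (Real.exp (-2) / 2 / (Real.sqrt Γ)⁻¹) -
      Real.exp (-2) / 2 / Real.sqrt ((Real.exp (-2) / 2) ^ 2 + ((Real.sqrt Γ)⁻¹) ^ 2) := by
  have hG : 0 < Real.sqrt Γ := Real.sqrt_pos.2 hΓ
  have hδ : 0 < Real.exp (-2) / 2 := by positivity
  have hy : Real.exp (-2) / 2 / (Real.sqrt Γ)⁻¹ = Real.exp (-2) / 2 * Real.sqrt Γ := by rw [div_inv_eq_mul]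
  have h1 : Real.log Γ / 2 - 2 ≤ Real.arsinh (Real.exp (-2) / 2 / (Real.sqrt Γ)⁻¹) := by
    rw [hy]
    refine le_trans (le_of_eq ?_) (arsinh_ge_log_two_mul (by positivity))
    rw [show 2 * (Real.exp (-2) / 2 * Real.sqrt Γ) = Real.exp (-2) * Real.sqrt Γ by ring,
      Real.log_mul (Real.exp_pos _).ne' hG.ne', Real.log_exp, Real.log_sqrt hΓ.le]
    ring
  have h2 : Real.exp (-2) / 2 / Real.sqrt ((Real.exp (-2) / 2) ^ 2 + ((Real.sqrt Γ)⁻¹) ^ 2) ≤ 1 := by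
    rw [div_le_one (Real.sqrt_pos.2 (by positivity))]
    exact Real.le_sqrt_of_sq_le (by nlinarith [sq_nonneg ((Real.sqrt Γ)⁻¹)])
  linarith

/-- **Numeric constants of the true-kernel rung.**  See the module docstring. [folklore] -/
theorem defect_constants {Γ Rb Λ η : ℝ} (hRb0 : 0 < Rb) (hRb : Rb ≤ 1 / 500) (hΓ : Real.exp (1 / Rb ^ 2) ≤ Γ)
    (hΛ : Λ = Real.arsinh (Real.exp (-2) / 2 / (Real.sqrt Γ)⁻¹) -
      Real.exp (-2) / 2 / Real.sqrt ((Real.exp (-2) / 2) ^ 2 + ((Real.sqrt Γ)⁻¹) ^ 2))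
    (hη : η = (Γ * 4 / (4 * Real.pi) * Λ)⁻¹) :
    (10 : ℝ) ^ 4 ≤ Γ ∧ 0 < Λ ∧ 0 < η ∧ η * (Γ * Real.log Γ) ≤ 7 ∧
    Real.sqrt Γ * (η * ((47 / 10) * (Real.sqrt Γ / 5 + 6 / 5 * (Rb * Real.sqrt (Γ * Real.log Γ))) +
      17 / 10 * Real.sqrt Γ)) ≤ 1 / 4000 ∧
    Γ * (η * (3 / (6 / 5 * (Rb * Real.sqrt (Γ * Real.log Γ)) - 11 / 10 * (Rb * Real.sqrt (Γ * Real.log Γ)))) *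
        ((47 / 10) * (Real.sqrt Γ / 5 + 6 / 5 * (Rb * Real.sqrt (Γ * Real.log Γ))) + 17 / 10 * Real.sqrt Γ) +
      η * (η * ((47 / 10) * (Real.sqrt Γ / 5 + 6 / 5 * (Rb * Real.sqrt (Γ * Real.log Γ))) + 17 / 10 * Real.sqrt Γ) *
        ((47 / 10) * (Real.sqrt Γ / 5 + 6 / 5 * (Rb * Real.sqrt (Γ * Real.log Γ))) + 17 / 10 * Real.sqrt Γ) +
        (47 / 10 + (12 + 710 * (1 / 3000))))) ≤ 1 / 140 := by
  have hRb2 : 250000 ≤ 1 / Rb ^ 2 := by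
    rw [le_div_iff₀ (by positivity)]; nlinarith
  have hexp : 1 / Rb ^ 2 + 1 ≤ Real.exp (1 / Rb ^ 2) := Real.add_one_le_exp _
  have hΓ4 : (10 : ℝ) ^ 4 ≤ Γ := by linarith
  have hΓ0 : 0 < Γ := by linarith
  set G : ℝ := Real.sqrt Γ with hGdef
  have hG : 0 < G := Real.sqrt_pos.2 hΓ0
  have hG2 : G ^ 2 = Γ := Real.sq_sqrt hΓ0.le
  set L : ℝ := Real.log Γ with hLdef
  have hL : 1 / Rb ^ 2 ≤ L := by
    have := Real.log_le_log (Real.exp_pos _) hΓ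
    rwa [Real.log_exp] at this
  have hL5 : 250000 ≤ L := hRb2.trans hL
  have hL0 : 0 < L := by linarith
  set M : ℝ := Real.sqrt L with hMdef
  have hM : 0 < M := Real.sqrt_pos.2 hL0
  have hM2 : M ^ 2 = L := Real.sq_sqrt hL0.le
  have hRbM : 1 ≤ Rb * M := by
    have h1 : 1 / Rb ≤ M := by
      rw [hMdef, ← Real.sqrt_sq (by positivity : (0:ℝ) ≤ 1 / Rb)]
      exact Real.sqrt_le_sqrt (by rw [div_pow, one_pow]; exact hL)
    have := mul_le_mul_of_nonneg_left h1 hRb0.le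
    rwa [mul_one_div_cancel hRb0.ne'] at this
  have hGM : Real.sqrt (Γ * Real.log Γ) = G * M := by
    rw [hGdef, hMdef, hLdef, Real.sqrt_mul hΓ0.le]
  rw [hGM]
  -- the local-induction coefficient and `K = ηΓ = π/Λ`
  have hΛlo : L / 2 - 3 ≤ Λ := by rw [hΛ, hLdef, hGdef]; exact lia_coefficient_lower hΓ0
  have hΛ0 : 0 < Λ := by linarith
  have hπ := Real.pi_gt_three
  have hπ' := Real.pi_lt_d2
  have hη0 : 0 < η := by rw [hη]; positivity
  obtain ⟨K, hK⟩ : ∃ K : ℝ, K = η * Γ := ⟨_, rfl⟩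
  have hKeq : K = Real.pi / Λ := by
    rw [hK, hη]; field_simp
  have hK0 : 0 < K := by rw [hKeq]; positivity
  have hKL : K * L ≤ 32 / 5 := by
    rw [hKeq, div_mul_eq_mul_div, div_le_iff₀ hΛ0]
    have h1 : Real.pi * L ≤ 3.15 * L := mul_le_mul_of_nonneg_right hπ'.le hL0.le
    linarith
  have hKL7 : K * L ≤ 7 := by linarith
  -- `K ≤ 6.4/L ≤ 6.4 Rb²` and `K·(Rb M) ≤ K (Rb M)² = K L Rb² ≤ 6.4 Rb²`
  have hKRb : K ≤ 32 / 5 * Rb ^ 2 := by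
    have h1 : K * L * Rb ^ 2 ≤ 32 / 5 * Rb ^ 2 := mul_le_mul_of_nonneg_right hKL (sq_nonneg Rb)
    have h2 : K ≤ K * L * Rb ^ 2 := by
      have h3 : 1 ≤ L * Rb ^ 2 := by
        have := mul_le_mul_of_nonneg_right hL (sq_nonneg Rb)
        rwa [one_div_mul_cancel (by positivity : Rb ^ 2 ≠ 0)] at this
      have := mul_le_mul_of_nonneg_left h3 hK0.le
      rw [mul_one, ← mul_assoc] at this
      exact this
    linarith
  have hKRbM : K * (Rb * M) ≤ 32 / 5 * Rb ^ 2 := by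
    have h1 : K * (Rb * M) ≤ K * (Rb * M) ^ 2 := by
      refine mul_le_mul_of_nonneg_left ?_ hK0.le
      have := mul_le_mul_of_nonneg_left hRbM (le_trans zero_le_one hRbM)
      rw [mul_one, ← sq] at this
      exact this
    have h2 : K * (Rb * M) ^ 2 = K * L * Rb ^ 2 := by rw [mul_pow, hM2]; ring
    calc K * (Rb * M) ≤ K * (Rb * M) ^ 2 := h1
      _ = K * L * Rb ^ 2 := h2
      _ ≤ 32 / 5 * Rb ^ 2 := mul_le_mul_of_nonneg_right hKL (sq_nonneg Rb)
  have hRb2' : Rb ^ 2 ≤ 1 / 250000 := by nlinarith [hRb0]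
  -- the waist-unit curvature `κ̃₀ = K (2.64 + 5.64 Rb M)`
  have hA : G * (η * ((47 / 10) * (G / 5 + 6 / 5 * (Rb * (G * M))) + 17 / 10 * G)) =
      K * (66 / 25 + 141 / 25 * (Rb * M)) := by
    rw [hK, ← hG2]; ring
  have hκ : K * (66 / 25 + 141 / 25 * (Rb * M)) ≤ 1 / 4000 := by
    have : K * (66 / 25 + 141 / 25 * (Rb * M)) = 66 / 25 * K + 141 / 25 * (K * (Rb * M)) := by ring
    rw [this]; linarith [hKRb, hKRbM, hRb2']
  have hηΓL : η * (Γ * L) ≤ 7 := by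
    have : η * (Γ * L) = K * L := by rw [hK]; ring
    rw [this]; exact hKL7
  refine ⟨hΓ4, hΛ0, hη0, hηΓL, by rw [hA]; exact hκ, ?_⟩
  -- the waist-unit modulus
  have hS : 6 / 5 * (Rb * (G * M)) - 11 / 10 * (Rb * (G * M)) = (Rb * (G * M)) / 10 := by ring
  have hRGM : 0 < Rb * (G * M) := by positivity
  have hD : Γ * (η * (3 / (6 / 5 * (Rb * (G * M)) - 11 / 10 * (Rb * (G * M))))) *
      ((47 / 10) * (G / 5 + 6 / 5 * (Rb * (G * M))) + 17 / 10 * G) =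
      30 * K * (66 / 25 / (Rb * M) + 141 / 25) := by
    rw [hS, hK]; field_simp; ring
  have hD' : 30 * K * (66 / 25 / (Rb * M) + 141 / 25) ≤ 30 * K * (66 / 25 + 141 / 25) := by
    refine mul_le_mul_of_nonneg_left (add_le_add ?_ le_rfl) (by positivity)
    rw [div_le_iff₀ (by positivity)]
    linarith [mul_le_mul_of_nonneg_left hRbM (by norm_num : (0:ℝ) ≤ 66 / 25)]
  have hsq : Γ * (η * (η * ((47 / 10) * (G / 5 + 6 / 5 * (Rb * (G * M))) + 17 / 10 * G) *
      ((47 / 10) * (G / 5 + 6 / 5 * (Rb * (G * M))) + 17 / 10 * G))) = (K * (66 / 25 + 141 / 25 * (Rb * M))) ^ 2 := by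
    rw [hK, ← hG2]; ring
  have hsq' : (K * (66 / 25 + 141 / 25 * (Rb * M))) ^ 2 ≤ 1 / 4000 * (1 / 4000) := by
    have h0 : 0 ≤ K * (66 / 25 + 141 / 25 * (Rb * M)) := by positivity
    rw [sq]; exact mul_le_mul hκ hκ h0 (by norm_num)
  have hlin : Γ * (η * (47 / 10 + (12 + 710 * (1 / 3000)))) = K * (5081 / 300) := by rw [hK]; ring
  have htot : Γ * (η * (3 / (6 / 5 * (Rb * (G * M)) - 11 / 10 * (Rb * (G * M)))) *
        ((47 / 10) * (G / 5 + 6 / 5 * (Rb * (G * M))) + 17 / 10 * G) +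
      η * (η * ((47 / 10) * (G / 5 + 6 / 5 * (Rb * (G * M))) + 17 / 10 * G) *
        ((47 / 10) * (G / 5 + 6 / 5 * (Rb * (G * M))) + 17 / 10 * G) + (47 / 10 + (12 + 710 * (1 / 3000))))) =
      Γ * (η * (3 / (6 / 5 * (Rb * (G * M)) - 11 / 10 * (Rb * (G * M))))) *
        ((47 / 10) * (G / 5 + 6 / 5 * (Rb * (G * M))) + 17 / 10 * G) +
      Γ * (η * (η * ((47 / 10) * (G / 5 + 6 / 5 * (Rb * (G * M))) + 17 / 10 * G) *
        ((47 / 10) * (G / 5 + 6 / 5 * (Rb * (G * M))) + 17 / 10 * G))) +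
      Γ * (η * (47 / 10 + (12 + 710 * (1 / 3000)))) := by ring
  rw [htot, hD, hsq, hlin]
  linarith [hD', hsq', hKRb, hRb2', hK0]

/-- **The remainder of the quantitative local-induction lemma is small.**  For `0 ≤ κ̃₀ ≤ 1/4000`, `0 ≤ H̃ ≤ 1/140`,
`θ = 1/3000`, `c = 1 − θ`, `δ = e⁻²/2`, `c₁ = κ̃₀²/4 + 2H̃ + κ̃₀H̃ + H̃²`: the window condition `δ ≤ 1/(2c₁ + 2)` holds and
`4θ/(c³δ) + 2δ(2H̃ + (3/2)κ̃₀H̃ + H̃² + 9c₁) ≤ 1/20`. [folklore] -/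
theorem defect_rem {κ H : ℝ} (hκ0 : 0 ≤ κ) (hκ : κ ≤ 1 / 4000) (hH0 : 0 ≤ H) (hH : H ≤ 1 / 140) :
    Real.exp (-2) / 2 ≤ 1 / (2 * (κ ^ 2 / 4 + 2 * H + κ * H + H ^ 2) + 2) ∧
    4 * (1 / 3000) / ((1 - 1 / 3000) ^ 3 * (Real.exp (-2) / 2)) +
      2 * (Real.exp (-2) / 2) * (2 * H + 3 / 2 * κ * H + H ^ 2 + 9 * (κ ^ 2 / 4 + 2 * H + κ * H + H ^ 2)) ≤ 1 / 20 := by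
  obtain ⟨-, hup, hlo⟩ := exp_two_bounds
  have hκκ := mul_le_mul hκ hκ hκ0 (by norm_num)
  have hHH := mul_le_mul hH hH hH0 (by norm_num)
  have hκH := mul_le_mul hκ hH hH0 (by norm_num)
  have hc1 : κ ^ 2 / 4 + 2 * H + κ * H + H ^ 2 ≤ 3 / 200 := by nlinarith
  constructor
  · rw [le_div_iff₀ (by positivity)]
    calc Real.exp (-2) / 2 * (2 * (κ ^ 2 / 4 + 2 * H + κ * H + H ^ 2) + 2)
        ≤ 0.1354 / 2 * (2 * (3 / 200) + 2) :=
          mul_le_mul (by linarith) (by linarith) (by positivity) (by norm_num)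
      _ ≤ 1 := by norm_num
  · have h1 : 4 * (1 / 3000) / ((1 - 1 / 3000) ^ 3 * (Real.exp (-2) / 2)) ≤ 1 / 50 := by
      rw [div_le_iff₀ (by positivity)]; nlinarith
    have h2 : 2 * (Real.exp (-2) / 2) * (2 * H + 3 / 2 * κ * H + H ^ 2 + 9 * (κ ^ 2 / 4 + 2 * H + κ * H + H ^ 2)) ≤
        0.1354 * (3 / 200 + 9 * (3 / 200)) := by
      have hb : 2 * H + 3 / 2 * κ * H + H ^ 2 + 9 * (κ ^ 2 / 4 + 2 * H + κ * H + H ^ 2) ≤ 3 / 200 + 9 * (3 / 200) := by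
        nlinarith
      have hb0 : 0 ≤ 2 * H + 3 / 2 * κ * H + H ^ 2 + 9 * (κ ^ 2 / 4 + 2 * H + κ * H + H ^ 2) := by positivity
      calc _ = Real.exp (-2) * (2 * H + 3 / 2 * κ * H + H ^ 2 + 9 * (κ ^ 2 / 4 + 2 * H + κ * H + H ^ 2)) := by ring
        _ ≤ 0.1354 * (3 / 200 + 9 * (3 / 200)) := mul_le_mul hup hb hb0 (by norm_num)
    norm_num at h2
    linarith

end SelectionBoxRJRung

end Summit.NavierStokesRegularity.NavierStokesRegularity.Theorems
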